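import Literature.AlgebraicGeometry.Modules.SheafHomAdjunctionIso
import Literature.AlgebraicGeometry.Modules.TensorSheafHomAdjunction
import Literature.AlgebraicGeometry.Modules.PullbackTensorProduct
import HarnessLib

/-!
# Discharge of the named fact `PullbackTensorObjIso`: pull-back commutes with the tensor product of `𝒪`-modules
# (The Stacks Project, Tag 01CD = Modules, Lemma 17.16.4), for ARBITRARY modules

Layer `Literature/AlgebraicGeometry/Modules`. The named fact `Modules/PullbackTensorProduct.PullbackTensorObjIso` — for a
morphism of schemes `f : X ⟶ Y` and an `𝒪_Y`-module `N`, a natural isomorphism `(N ⊗ –) ⋙ f^* ≅ f^* ⋙ (f^*N ⊗ –)` of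
functors `Mod(𝒪_Y) ⥤ Mod(𝒪_X)` ("`f^*(𝓕 ⊗ 𝓖) = f^*𝓕 ⊗ f^*𝓖` functorially", Stacks 01CD; the tree had the comparison map
for all modules and its isomorphism half only for finite locally free factors, `Modules/PullbackTensor`,
`Modules/PullbackTensorOfLocallyFree`) — is PROVED for arbitrary `N` and arbitrary second factor, by UNIQUENESS OF LEFT
ADJOINTS (Mathlib `Adjunction.leftAdjointUniq`):

* `(N ⊗ –) ⋙ f^*` is left adjoint to `f_* ⋙ 𝓗om(N, –)` (the tensor–hom adjunction
  `Modules/TensorSheafHomAdjunction.tensorSheafHomAdj N` composed with `f^* ⊣ f_*`, Mathlib `Adjunction.comp`);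
* `f^* ⋙ (f^*N ⊗ –)` is left adjoint to `𝓗om(f^*N, –) ⋙ f_*`;
* the two right adjoints are isomorphic: `𝓗om_Y(N, f_*(–)) ≅ f_*𝓗om_X(f^*N, –)` is the internal adjunction isomorphism
  for ARBITRARY `N` (`Modules/SheafHomAdjunctionIso.isIso_sheafHomAdjunctionComparison'`, natural by
  `sheafHomAdjunctionComparison_naturality`).

One theorem, no definitions, no instances; no consumer of the fact is edited (fed by name).

## References

* The Stacks Project, Tag 01CD (Modules, Lemma 17.16.4: `f^*(𝓕 ⊗ 𝓖) = f^*𝓕 ⊗ f^*𝓖` functorially in `𝓕`, `𝓖`),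
  Tag 01CM (internal Hom and `f_*𝓗om(f^*𝒢, 𝓕) = 𝓗om(𝒢, f_*𝓕)`), Tag 01CN (tensor–hom). [StacksProject]
* U. Görtz, T. Wedhorn, *Algebraic Geometry I: Schemes*, 2nd ed. (2020), (7.8.2)–(7.8.3). [GortzWedhorn2020]
* R. Hartshorne, *Algebraic Geometry*, GTM 52 (1977), II.5 p. 110, II Ex. 5.1 (c). [Hartshorne1977]
-/

noncomputable section

-- `TopCat.Presheaf`/`Scheme.Modules` are not reducible (as in Mathlib's `AlgebraicGeometry/Modules/Sheaf.lean`).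
set_option backward.isDefEq.respectTransparency false

open CategoryTheory AlgebraicGeometry Opposite TopologicalSpace Limits

universe u

namespace Literature.AlgebraicGeometry.Modules

open Literature.AlgebraicGeometry.Motives

/-- **Stacks 01CD holds: `f^*(N ⊗ M) ≅ f^*N ⊗ f^*M`, naturally in `M`, for ARBITRARY `𝒪_Y`-modules** — the named fact
`PullbackTensorObjIso`, discharged by uniqueness of left adjoints: both `(N ⊗ –) ⋙ f^*` and `f^* ⋙ (f^*N ⊗ –)` are left
adjoint to (functors isomorphic to) `f_*𝓗om(f^*N, –) ≅ 𝓗om(N, f_*(–))`.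
[cite: StacksProject, Tag 01CD (Modules, Lemma 17.16.4)] [cite: GortzWedhorn2020, (7.8.2)–(7.8.3)] -/
theorem PullbackTensorObjIso_holds : PullbackTensorObjIso.{u} := by
  intro X Y f N
  haveI := fun P => isIso_sheafHomAdjunctionComparison' f N P
  -- the internal adjunction isomorphism of the right adjoints
  let e : Scheme.Modules.pushforward f ⋙ sheafHomFunctor N ≅
      sheafHomFunctor ((Scheme.Modules.pullback f).obj N) ⋙ Scheme.Modules.pushforward f :=
    NatIso.ofComponents (fun P => asIso (sheafHomAdjunctionComparison f N P))
      (fun g => sheafHomAdjunctionComparison_naturality f N g)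
  -- the two composite adjunctions
  let adj₁ : (tensorBifunctor Y).obj N ⋙ Scheme.Modules.pullback f ⊣
      Scheme.Modules.pushforward f ⋙ sheafHomFunctor N :=
    (tensorSheafHomAdj N).comp (Scheme.Modules.pullbackPushforwardAdjunction f)
  let adj₂ : Scheme.Modules.pullback f ⋙ (tensorBifunctor X).obj ((Scheme.Modules.pullback f).obj N) ⊣
      sheafHomFunctor ((Scheme.Modules.pullback f).obj N) ⋙ Scheme.Modules.pushforward f :=
    (Scheme.Modules.pullbackPushforwardAdjunction f).comp (tensorSheafHomAdj ((Scheme.Modules.pullback f).obj N))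
  exact ⟨adj₁.leftAdjointUniq (adj₂.ofNatIsoRight e.symm)⟩

end Literature.AlgebraicGeometry.Modules

end
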